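import Mathlib
import Literature.AlgebraicGeometry.Resolution.LocalBlowup
import Literature.AlgebraicGeometry.Resolution.ExcellentRings
import HarnessLib

/-!
# Cossart–Piltant 2019, Theorem 1.5 (i): the base-side tower of the `m = p` phase

Topic `Literature/AlgebraicGeometry/CossartPiltant200819`.  ONE named fact (lean/CONVENTIONS.md §4), no proof:
`CossartPiltant2019_thm_1_5_i_baseSidePhase`.  Requested by planner `res-B-lens-5` g6 (crux
`stmt-ResolutionOfSingularities-0549`, customer `stub_cleanLU3Defect` of `stmt-ResolutionOfSingularities-15917`), work item
wi-91399.

Source (published, refereed): V. Cossart, O. Piltant, *Resolution of singularities of arithmetical threefolds*,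
J. Algebra **529** (2019) 268–535 [CossartPiltant2019] (below «p. N» is the journal page; PDF page = N − 267):
* Theorem 1.5, pp. 271–272, case (i) (`char K = p`, `h = X^p + f_p`): «Let `μ` be a valuation of `L` which is centered in
  `m_S`. There exists a composition of local Hironaka-permissible blowing ups `(𝒳 =: 𝒳₀,x₀) ← (𝒳₁,x₁) ← ⋯ ← (𝒳_r,x_r)` (1.2)
  where `x_i ∈ 𝒳_i` is the center of `μ`, such that `(𝒳_r,x_r)` is regular.»
* Corollary 5.6, p. 405 («Theorems 1.1 and 1.5 hold true») and its proof: «By Corollary 4.19, it can be furthermore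
  assumed that condition (E) is satisfied. Theorem 1.5 is then an immediate consequence of [31] Main Theorem 1.3
  (`m(x) < p`), Theorem 2.81 (`(m(x), ω(x)) = (p, 0)`) and Theorem 5.5.»  The printed proof therefore splits (1.2) into
  the phase `m(x_i) = p` (Cor. 4.19, Thm. 2.81, Thm. 5.5 — all in THIS paper) followed by the phase `m(x_i) < p`
  ([31] = Cossart–Piltant, RACSAM 108 (2014), small multiplicity).  THIS FACT TYPES ONLY THE FIRST PHASE and ends
  where the paper hands over to [31]: at a centre `x_n` of multiplicity `m(x_n) < p`.
* The blowing ups of the first phase.  Lemma 4.14 (p. 398, `dim S = 3`) and Corollary 4.19 (p. 402): «There exists a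
  composition of Hironaka-permissible blowing ups (2.17) w.r.t. `E = ∅`» (a commutative square over the blowing ups
  `σ` of the base `Spec S`).  Theorem 2.81 (p. 341): «Assume that `(m(x), ω(x)) = (p, 0)` … For every valuation `μ` of
  `L` centered at `x`, there exists a finite and independent composition of local Hironaka-permissible blowing ups
  (2.87) such that `m(x_r) < p`», proof l. 1: «We will produce a Hironaka-permissible center `𝒴 ⊂ (𝒳, x)` w.r.t. `E`».
  Sequences (5.3) (p. 404): «finite sequences of local blowing ups along `μ` … with Hironaka-permissible centers
  `𝒴_i ⊂ (𝒳_i, x_i)`, where `x_i` denotes the center of `μ` … all permissibility conditions (Definitions 2.20, 3.1 and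
  3.5) always refer to the reduced total transform `E_i` of `E` in `S_i`, where there are projections
  `η_i : (𝒳_i, x_i) → Spec S_i`»; Definition 5.4 / Theorem 5.5 (Projection Theorem, p. 405): «resolved for `m(x) = p`
  … `m(x_r) < p`», «For every valuation `μ` of `L = k(𝒳)` centered at `x`, there exists a finite and independent
  composition of local Hironaka-permissible blowing ups (5.3) such that `ι(x_r) < ι(x)`».  §5.1, p. 403: «Since our
  assumptions (G) and (E) are stable when changing `(S, h, E)` to `(S_s, h_s, E_s)` (Notation 2.23), we may assume that
  `s = m_S`» (centres which are non-closed points of the base are treated after localising the base).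
* The shape of ONE such blowing up, Definitions 2.20/2.21 (p. 293) and Proposition 2.22 with (2.17)/(2.18)
  (pp. 294–295): for a Hironaka-permissible blowing up w.r.t. `E` along `𝒴`, `W := η(𝒴)` is regular, the base is blown
  up along `W` (`σ : 𝒮' → Spec S`), and «For every `s' ∈ σ⁻¹(s)`, `S' := O_{𝒮',s'}`, there exists `h' ∈ S'[X']` monic
  of degree `m` such that `𝒳'_{s'} = Spec (S'[X']/(h'))`», with `X' := Z/u_{j₀}`, `Z = X - θ`, `θ ∈ S`, and
  «`h' := u_{j₀}^{-m} h(Z)`» (2.18) («the point at infinity does not belong to `𝒳'`», proof of 2.22, by Prop. 2.10,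
  p. 288).  For `h = X^p - g` in characteristic `p` this reads `h(Z) = Z^p - (g - θ^p)` and
  `h' = X'^p - (u^{-p} g - (θ/u)^p)`, i.e. the new radicand is `g' = c^p g + d^p` with `c = u⁻¹ ≠ 0`, `d = -θ/u`.

Design.  The body is, VERBATIM, the tower of the tree's (refuted, see below) `CossartPiltant2019_thm_1_5_i_frame`
(`Thm15FrameSHE2019.lean`, same directory, deliberately NOT imported) with its END clause replaced: instead of
«`(B n)[X]/(X^p - g n)` is regular» it asserts the printed end-state of the `m = p` phase, «the multiplicity of
`𝒳_n = Spec (B n)[X]/(X^p - g n)` at its (unique, Prop. 2.10) point `x_n` over the closed point of `B n` is `< p`», in the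
base-side dictionary `∀ c ∈ B n, g n - c^p ∉ 𝔪_{B n}^p`.  (Dictionary, `B n` regular local with maximal ideal `𝔪`,
residue field `κ`: if the residue `ḡ` of `g = g n` is not a `p`-th power in `κ`, then `X^p - ḡ` is irreducible over `κ`,
`x_n` is a regular point (`m(x_n) = 1 < p`) and `g - c^p` is a unit for every `c`; if `ḡ = c̄^p`, then in the coordinate
`X' = X - c` one has `h = X'^p - (g - c^p)` and `m(x_n) = ord_{(𝔪, X')} h = min (p, ord_𝔪 (g - c^p))` because
`gr_{(𝔪,X')} = gr_𝔪(B n)[X']`; so `m(x_n) < p ⟺ ∀ c, g - c^p ∉ 𝔪^p`.)  Equivalently: the body is, token for token,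
`∀ p : ℕ, p.Prime → CpBaseSidePhaseAt p` for the hypothesis shape `CpBaseSidePhaseAt` of the requesting crux census
(`Summits/ResolutionOfSingularities/ResolutionOfSingularities/Cruxes/DescentPerfectToAll/Census_lens5_cpBaseSide.lean`,
namespace `Summit.ResolutionOfSingularities.ResolutionOfSingularities.Cruxes.DescentPerfectToAll.CpSibling.BaseSide`), so
that the consumer's bridge is `Iff.rfl`.  Vocabulary: `Literature.AlgebraicGeometry.Resolution.locAtCentre`,
`….IsLocalBlowupAlong` (`Resolution/LocalBlowup.lean`), `….IsExcellentRing` (`Resolution/ExcellentRings.lean`); Mathlib's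
`ValuationSubring`, `IsRegularLocalRing`, `ringKrullDim`, `CharP`, `IsFractionRing`.

Reading of the binders (all hypotheses of Thm. 1.5 (i) are present): `S` excellent regular local of dimension `3`;
`CharP S p` is case (i) «`char K = p`»; `h := X^p - f` with `f ∉ K^p` (`∀ c : K, c^p ≠ f`) is a reduced — indeed
irreducible — instance of (1.1) with `f₁ = ⋯ = f_{p-1} = 0`, and `L = K[X]/(h)` is a field purely inseparable over `K`,
so «a valuation `μ` of `L` centered in `m_S`» is the same as a valuation ring `O` of `K` dominating `S`
(`S ≤ O` and `𝔪_S ⊆ 𝔪_O`, typed `O.valuation s < 1`); the centre `x_i` of `μ` on `𝒳_i` is the unique point over the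
centre `s_i` of `O` on the blown-up base, and `B i = O_{𝒮_i, s_i}` (`B 0 = locAtCentre S O = S` as `O` dominates `S`);
`IsLocalBlowupAlong O (B i) P (B (i+1))` with `(B i) ⧸ P` regular is the base blowing up `σ` of (2.17) along the regular
`W = V(P)`, localised at the centre of `O`; `g (i+1) = c^p * g i + d^p`, `c ≠ 0`, is (2.18).  Steps of a global
composition (2.17) whose centre misses the current centre of `O` change nothing locally and are simply not listed
(`n`, `B`, `g` are existential).

What is deliberately NOT asserted (each omission WEAKENS the printed conclusion): the multiplicity clause
`m(y) = m(x) = p` of Def. 2.20 for the centres (only regularity of `W`, as `IsRegularLocalRing ((B i) ⧸ P)`); the normal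
crossings of `W` with `E_i` and condition (E); independence of the sequence from `μ` (Def. 2.77); the invariants
`(m, ω, κ, ι)` and their monotonicity; the specific chart values `(c, d) = (u⁻¹, -θ/u)`; anything about the second phase
[31] and the final regularity of (1.2).

Relation to the REFUTED frame (F-110).  `CossartPiltant2019_thm_1_5_i_frame` (same tower, END clause «regular») is false
as typed (tree: `Summit.….CleanModels.Negative` / `NegationLens6g3.F110False`, witness `p = 5`, `f = x²y`, where
`m(x₀) = 3 < 5` so the `m = p` phase is EMPTY and no base-side step can regularise): it over-read the end of (1.2), whose
last phase [31] is not of the form (2.17)/(2.18).  The present fact is strictly weaker (regular ⟹ `∀ c, g - c^p ∉ 𝔪² ⊇ 𝔪^p`;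
tree: `baseSidePhaseAt_of_frameAt`), holds trivially with `n = 0` at that witness, and coincides with the frame exactly at
`p = 2` (tree: `frameAt_two_iff_baseSidePhaseAt_two`; for `p = 2`, «`m < p`» means regular and the phase [31] is empty).
It is NOT a re-filing of F-110.

Scope caveat (recorded, not typed): Theorem 1.5 is printed for EVERY valuation `μ` of `L` centred in `m_S`, and
Theorems 2.81/5.5 for «every valuation `μ` of `L` centered at `x`»; the residual-algebraicity restriction appearing in
the first sentence of the proof of Cor. 5.6 («Theorem 1.1 has been reduced to Theorem 1.5 for residually algebraic
valuations, Propositions 4.6 and 4.10») concerns the reduction of Thm. 1.1, not the statement of Thm. 1.5, and the body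
below follows the print (all dominating `O`).  For a valuation whose centre `s_i` on a blown-up base has
`dim O_{𝒮_i,s_i} < 3` the paper computes its invariants after localising the base (§5.1, p. 403, quoted above;
Remark 5.2 for codimension two; «`ω(y) = ε(y) = 0` in codimension one», whence Thm. 2.81).

**Caveat: this types a printed theorem, read through the structure of its printed proof, as a `Prop`; it proves
nothing.  AI reading is weaker than expert review (the sibling F-110 is the standing example).**
-/

open Literature.AlgebraicGeometry.Resolution

namespace Literature.AlgebraicGeometry.CossartPiltant200819

universe u

/-- **Cossart–Piltant 2019, Theorem 1.5 (i) — the `m = p` phase, base side.**  Let `S` be an excellent regular local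
ring of dimension `3` and characteristic `p` with fraction field `K`, `f ∈ S` not a `p`-th power in `K` (so
`h = X^p - f` is case (i) of (1.1) and `L = K(f^{1/p})` is purely inseparable over `K`), and `O` a valuation ring of `K`
dominating `S` (= a valuation of `L` centred in `m_S`).  Then there is a finite tower of regular local rings
`S = B 0, B 1, …, B n` inside `O`, each `B (i+1)` the local blowing up, at the centre of `O`, of `B i` along an ideal
`P` with `(B i)/P` regular (the base square (2.17) of a local Hironaka-permissible blowing up, Prop. 2.22), together with
radicands `g i ∈ B i`, `g 0 = f`, `g (i+1) = c^p · g i + d^p` with `c ≠ 0` (the chart formula (2.18):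
`h' = u^{-p} h(Z)`), such that at the last stage the multiplicity of `Spec (B n)[X]/(X^p - g n)` at its point over the
closed point of `B n` is `< p`, i.e. `g n - c^p ∉ 𝔪_{B n}^p` for every `c ∈ B n` — the end-state «`m(x_r) < p`» of the
phase of (1.2) produced by Cor. 4.19, Thm. 2.81 and Thm. 5.5 in the proof of Cor. 5.6, before [31] takes over.
Strictly weaker than the refuted `CossartPiltant2019_thm_1_5_i_frame` (END clause «regular»); see the module docstring
for the dictionary, the omissions (all weakenings) and the scope caveat.
[cite: CossartPiltant2019, Thm. 1.5 (i) pp. 271–272; Cor. 5.6 p. 405 (proof); Prop. 2.22 with (2.17)/(2.18) pp. 294–295; Def. 2.20/2.21 p. 293; Prop. 2.10 p. 288; Thm. 2.81 p. 341; Lemma 4.14 p. 398; Cor. 4.19 p. 402; (5.3) p. 404; Def. 5.4, Thm. 5.5 p. 405] -/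
def CossartPiltant2019_thm_1_5_i_baseSidePhase : Prop :=
  ∀ (p : ℕ), p.Prime →
    ∀ (S : Type u) [CommRing S] [IsRegularLocalRing S],
      IsExcellentRing S → ringKrullDim S = 3 → CharP S p →
    ∀ (K : Type u) [Field K] [Algebra S K] [IsFractionRing S K] (f : S),
      (∀ c : K, c ^ p ≠ algebraMap S K f) →
    ∀ (O : ValuationSubring K), (algebraMap S K).range ≤ O.toSubring →
      (∀ s ∈ IsLocalRing.maximalIdeal S, O.valuation (algebraMap S K s) < 1) →
    ∃ (n : ℕ) (B : ℕ → Subring K) (g : ℕ → K),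
      B 0 = locAtCentre (algebraMap S K).range O ∧ g 0 = algebraMap S K f ∧
      (∀ i ≤ n, B i ≤ O.toSubring ∧ IsRegularLocalRing (B i) ∧ g i ∈ B i) ∧
      (∀ i < n, ∃ P : Ideal (B i), IsRegularLocalRing ((B i) ⧸ P) ∧
        IsLocalBlowupAlong O (B i) P (B (i + 1)) ∧
        ∃ c d : K, c ≠ 0 ∧ g (i + 1) = c ^ p * g i + d ^ p) ∧
      ∀ (hg : g n ∈ B n) (_hBn : IsRegularLocalRing (B n)) (c : B n),
        (⟨g n, hg⟩ : B n) - c ^ p ∉ IsLocalRing.maximalIdeal (B n) ^ p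

end Literature.AlgebraicGeometry.CossartPiltant200819
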